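import Summits.PneNP.PneNP.Theses.RootDecompSpaceCeiling
import Summits.PneNP.PneNP.Theses.RootDecompQuantumCell
import Literature.Computability.Complexity.Classes
import Literature.Computability.Complexity.Nondeterministic
import Literature.Computability.Complexity.NondeterministicProofs
import Literature.Computability.Complexity.PolyHierarchy
import Literature.Computability.Complexity.Counting
import Literature.Computability.Complexity.Oracle
import Literature.Computability.Complexity.OracleEmpty
import Literature.Computability.Complexity.OracleProofs
import Literature.Computability.Complexity.PRelHierarchy
import Literature.Computability.Complexity.BakerGillSolovay
import Literature.Computability.Cryptography.ClassBQP
import Literature.Computability.Cryptography.ClassBQPRelProofs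
import Literature.Computability.QuantumComplexity.BQP
import Literature.Computability.QuantumComplexity.CountingSimulation
import Literature.Computability.QuantumComplexity.CountingSimulationRel
import Literature.Computability.QuantumComplexity.BQPSubsetAWPP
import Literature.Computability.QuantumComplexity.AccGapMachine
import Literature.Barriers.PneNP.Relativization
import Literature.Barriers.QuantumAdvantage.Relativization

/-!
# `RootDecompSpaceCeiling.CollapseLift` (stmt-PneNP-23703) — the RELATIVIZED LEDGER of the counting sandwich (Part B of the lens-4 support file, definition-free)

Support file (S-free; closes no item, defines nothing) for the hub residual of the decomp-pnenp root-decomposition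
cell, `K = RootDecompSpaceCeiling.CollapseLift := NP ⊆ P → PP ⊆ P`, and for N19's quantum cell
(`RootDecompQuantumCell.QLift` stmt-PneNP-29732, `QCatch` 32697, tests `TQC`/`TQL`/`TQI` 32698–32700).
Companion of `Theorems/RootDecompSpaceCeilingCountingSandwich.lean` (Part A, §§0–4, hypothesis-free sandwich laws);
this is Part B = §§5–7 of the lens-4 g14 LANDING-READY file
(HOME/decomp-pnenp-lens-4/g14/RootDecompSpaceCeilingCountingSandwich.lean sha256 e642c5ae…, critic-endorsed
2026-08-30T12:08:03Z for `--supports stmt-PneNP-23703`), ported WITHOUT the four Set-valued world-set definitions of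
the lens file: every statement is written world by world over a language oracle `B` («collapsing world» =
`NP^B ⊆ P^B`; «K-world» = `NP^B ⊆ P^B → PP^B ⊆ P^B`; «lift-world of 𝒞» = `NP^B ⊆ P^B → 𝒞^B ⊆ P^B`; «catch-world of 𝒞»
= `NP^B ⊆ P^B → PP^B ⊆ 𝒞^B`), with `𝒞^B` an oracle-indexed class `C : Oracle → Set (Language Bool)` and BQP in the
canonical presentation `bqpRelOf`.

CONTENT. §5 hypothesis-free: relativized glue and FAILURE PATTERN, the critic's ZERO-SUM OF CERTIFICATES, a
Baker–Gill–Solovay non-collapsing world makes every lift / catch / K hold vacuously somewhere (so none is refutable by a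
relativizing argument), the empty-oracle ANCHORS to the items K / `QLift` / `QCatch`, the RELATIVIZED Meyer–Stockmeyer
collapse `NP^O ⊆ P^O ⟹ PH^O ⊆ P^O` and the PHASE LAW (a mechanism inside `PH^O` lifts in every world, so its catch IS K
world by world). §6 modulo the print binder «AIK22 Thm 10» (`∃ B, NP^B ⊆ P^B ∧ PP^B ⊄ P^B ∧ PP^B ⊆ BQP^B`, a
HYPOTHESIS): the quantum catch and the AWPP catch are relativized-STRICTLY BELOW K; the BQP-lift, the AWPP-lift and K have
no relativizing proof. §7 modulo the print binder «AIK22 Thm 4 / Cor 45» (a HYPOTHESIS, the antecedent of item 32933):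
the quantum catch FAILS in some collapsing world (two-sided), row (F,F) of the world table is realized, `TQL` is EXACTLY
the strictness of `QLift` below K, the AWPP test implies the BQP test. Named tree fact used as a hypothesis where needed:
`PRel_ofLanguage_subset_BQPRel` (`P^B ⊆ BQP^B`).
0 sorry; axioms ⊆ {propext, Classical.choice, Quot.sound}.
[cite: AaronsonIngramKretschmer2022, Thm. 10 (p. 8), Thm. 4 (p. 6), Cor. 43–45 (pp. 24–25)]
[cite: FortnowRogers1999JCSS, Thm. 3.1] [cite: BernsteinVazirani1997SICOMP, Thm. 8.2]
[cite: BakerGillSolovay1975, Thm. 1] [cite: AroraBarakCC2009, §3.4, Thm. 5.4, §5.5]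
-/

namespace Summit.PneNP.PneNP.Theorems.RootDecompCountingSandwichWorlds

open Literature.Computability.Complexity
open Literature.Computability.Cryptography (BQP BQPRel)
open Literature.Computability.QuantumComplexity (AWPP AWPPRel)
open Literature.Barriers.PneNP (Relativizes)
open Literature.Barriers.QuantumAdvantage (bqpRelOf presentsBQPRel_bqpRelOf bqpRelOf_empty)
open Summit.PneNP.PneNP.Theses

/-! ## §5 The relativized ledger, world by world (hypothesis-free) -/

/-- Relativized GLUE: in every world, lift ∧ catch ⟹ K. [cite: BakerGillSolovay1975, Thm. 1] -/
theorem k_of_lift_of_catch (C : Oracle → Set (Language Bool)) (B : Language Bool)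
    (hL : NPRel (Oracle.ofLanguage B) ⊆ PRel (Oracle.ofLanguage B) → C (Oracle.ofLanguage B) ⊆ PRel (Oracle.ofLanguage B))
    (hC : NPRel (Oracle.ofLanguage B) ⊆ PRel (Oracle.ofLanguage B) → PPRel (Oracle.ofLanguage B) ⊆ C (Oracle.ofLanguage B)) :
    NPRel (Oracle.ofLanguage B) ⊆ PRel (Oracle.ofLanguage B) → PPRel (Oracle.ofLanguage B) ⊆ PRel (Oracle.ofLanguage B) :=
  fun hc => (hC hc).trans (hL hc)

/-- FAILURE PATTERN: a world where K fails loses at least one piece of the cell. [cite: BakerGillSolovay1975, Thm. 1] -/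
theorem fail_pattern (C : Oracle → Set (Language Bool)) (B : Language Bool)
    (hK : ¬ (NPRel (Oracle.ofLanguage B) ⊆ PRel (Oracle.ofLanguage B) →
      PPRel (Oracle.ofLanguage B) ⊆ PRel (Oracle.ofLanguage B))) :
    ¬ (NPRel (Oracle.ofLanguage B) ⊆ PRel (Oracle.ofLanguage B) → C (Oracle.ofLanguage B) ⊆ PRel (Oracle.ofLanguage B)) ∨
      ¬ (NPRel (Oracle.ofLanguage B) ⊆ PRel (Oracle.ofLanguage B) → PPRel (Oracle.ofLanguage B) ⊆ C (Oracle.ofLanguage B)) := by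
  by_contra h
  push Not at h
  exact hK (k_of_lift_of_catch C B h.1 h.2)

/-- ZERO-SUM OF CERTIFICATES (critic, hypothesis-free): a strictness witness of a catch piece (K fails, catch holds) is a
failing world of the lift piece of the same cell. [cite: BakerGillSolovay1975, Thm. 1] -/
theorem not_lift_of_strictCatch (C : Oracle → Set (Language Bool)) (B : Language Bool)
    (hK : ¬ (NPRel (Oracle.ofLanguage B) ⊆ PRel (Oracle.ofLanguage B) →
      PPRel (Oracle.ofLanguage B) ⊆ PRel (Oracle.ofLanguage B)))
    (hC : NPRel (Oracle.ofLanguage B) ⊆ PRel (Oracle.ofLanguage B) → PPRel (Oracle.ofLanguage B) ⊆ C (Oracle.ofLanguage B)) :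
    ¬ (NPRel (Oracle.ofLanguage B) ⊆ PRel (Oracle.ofLanguage B) → C (Oracle.ofLanguage B) ⊆ PRel (Oracle.ofLanguage B)) :=
  fun hL => hK (k_of_lift_of_catch C B hL hC)

/-- … and symmetrically: a strictness witness of a lift piece is a failing world of the catch piece.
[cite: BakerGillSolovay1975, Thm. 1] -/
theorem not_catch_of_strictLift (C : Oracle → Set (Language Bool)) (B : Language Bool)
    (hK : ¬ (NPRel (Oracle.ofLanguage B) ⊆ PRel (Oracle.ofLanguage B) →
      PPRel (Oracle.ofLanguage B) ⊆ PRel (Oracle.ofLanguage B)))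
    (hL : NPRel (Oracle.ofLanguage B) ⊆ PRel (Oracle.ofLanguage B) → C (Oracle.ofLanguage B) ⊆ PRel (Oracle.ofLanguage B)) :
    ¬ (NPRel (Oracle.ofLanguage B) ⊆ PRel (Oracle.ofLanguage B) → PPRel (Oracle.ofLanguage B) ⊆ C (Oracle.ofLanguage B)) :=
  fun hC => hK (k_of_lift_of_catch C B hL hC)

/-- Baker–Gill–Solovay: a NON-collapsing world exists (tree theorem `exists_oracle_PRel_ne_NPRel`).
[cite: BakerGillSolovay1975, Thm. 1] -/
theorem exists_not_collapse :
    ∃ B : Language Bool, ¬ (NPRel (Oracle.ofLanguage B) ⊆ PRel (Oracle.ofLanguage B)) := by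
  obtain ⟨B, hB⟩ := exists_oracle_PRel_ne_NPRel
  exact ⟨B, fun h => hB (Set.Subset.antisymm (PRel_subset_NPRel_holds (Oracle.ofLanguage B)) h)⟩

/-- HYPOTHESIS-FREE: outside the collapsing worlds every lift, every catch and K hold vacuously, so NO lift, NO catch and
NOT K can be REFUTED by a relativizing argument. [cite: BakerGillSolovay1975, Thm. 1] -/
theorem not_relativizes_neg (C : Oracle → Set (Language Bool)) :
    ¬ Relativizes (fun O => ¬ (NPRel O ⊆ PRel O → C O ⊆ PRel O)) ∧
      ¬ Relativizes (fun O => ¬ (NPRel O ⊆ PRel O → PPRel O ⊆ C O)) ∧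
      ¬ Relativizes (fun O => ¬ (NPRel O ⊆ PRel O → PPRel O ⊆ PRel O)) := by
  obtain ⟨B, hB⟩ := exists_not_collapse
  exact ⟨fun h => h B (fun hc => (hB hc).elim), fun h => h B (fun hc => (hB hc).elim),
    fun h => h B (fun hc => (hB hc).elim)⟩

/-- ANCHOR: the relativized K at the empty oracle is the item K (stmt-PneNP-23703). [cite: AroraBarakCC2009, §3.4] -/
theorem k_empty_iff : (NPRel Oracle.empty ⊆ PRel Oracle.empty → PPRel Oracle.empty ⊆ PRel Oracle.empty) ↔
    RootDecompSpaceCeiling.CollapseLift := by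
  unfold RootDecompSpaceCeiling.CollapseLift
  have hPP : PPRel Oracle.empty = PP := by
    rw [PPRel_eq, show PRel Oracle.empty = Classes.P from PRel_empty_holds]; rfl
  rw [hPP, NPRel_empty, show PRel Oracle.empty = Classes.P from PRel_empty_holds]

/-- ANCHOR: the relativized BQP-lift at the empty oracle is the item `QLift` (stmt-PneNP-29732).
[cite: BernsteinVazirani1997SICOMP, §8.3] -/
theorem qLift_empty_iff : (NPRel Oracle.empty ⊆ PRel Oracle.empty → bqpRelOf Oracle.empty ⊆ PRel Oracle.empty) ↔
    RootDecompQuantumCell.QLift := by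
  unfold RootDecompQuantumCell.QLift
  rw [bqpRelOf_empty Literature.Computability.Cryptography.BQPRel_zero_holds, NPRel_empty,
    show PRel Oracle.empty = Classes.P from PRel_empty_holds]

/-- ANCHOR: the relativized BQP-catch at the empty oracle is the item `QCatch` (stmt-PneNP-32697).
[cite: BernsteinVazirani1997SICOMP, §8.3] -/
theorem qCatch_empty_iff : (NPRel Oracle.empty ⊆ PRel Oracle.empty → PPRel Oracle.empty ⊆ bqpRelOf Oracle.empty) ↔
    RootDecompQuantumCell.QCatch := by
  unfold RootDecompQuantumCell.QCatch
  have hPP : PPRel Oracle.empty = PP := by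
    rw [PPRel_eq, show PRel Oracle.empty = Classes.P from PRel_empty_holds]; rfl
  rw [bqpRelOf_empty Literature.Computability.Cryptography.BQPRel_zero_holds, NPRel_empty, hPP,
    show PRel Oracle.empty = Classes.P from PRel_empty_holds]

/-! ### Phase law: mechanisms inside `PH` are costume cells in EVERY world -/

/-- `co (P^O) ⊆ P^O`. [cite: BakerGillSolovay1975, §1] -/
theorem co_PRel_subset (O : Oracle) : co (PRel O) ⊆ PRel O := fun L hL => by
  have h : Lᶜᶜ ∈ PRel O := compl_mem_PRel hL
  rwa [compl_compl] at h

/-- RELATIVIZED Meyer–Stockmeyer: `NP^O ⊆ P^O ⟹ Σₖ^O ⊆ P^O` for every `k`. [cite: AroraBarakCC2009, Thm. 5.4 with §5.5] -/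
theorem sigmaPRel_subset_PRel_of_collapse {O : Oracle} (hc : NPRel O ⊆ PRel O) :
    ∀ k, SigmaPRel O k ⊆ PRel O
  | 0 => subset_rfl
  | k + 1 => by
    intro L hL
    have ih := sigmaPRel_subset_PRel_of_collapse hc k
    have h1 : polyExists (co (sigmaP (PRel O) k)) ⊆ polyExists (PRel O) :=
      polyExists_mono ((co_mono ih).trans (co_PRel_subset O))
    exact hc (by rw [NPRel_eq]; exact h1 hL)

/-- `NP^O ⊆ P^O ⟹ PH^O ⊆ P^O`. [cite: AroraBarakCC2009, Thm. 5.4 with §5.5] -/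
theorem phRel_subset_PRel_of_collapse {O : Oracle} (hc : NPRel O ⊆ PRel O) : PHRel O ⊆ PRel O := by
  intro L hL
  obtain ⟨k, hk⟩ := Set.mem_iUnion.1 hL
  exact sigmaPRel_subset_PRel_of_collapse hc k hk

/-- PHASE LAW: a mechanism inside `PH^O` in every world LIFTS in every world (a relativizing theorem) …
[cite: AroraBarakCC2009, Thm. 5.4] -/
theorem relativizes_lift_of_inPH {C : Oracle → Set (Language Bool)} (hC : ∀ O, C O ⊆ PHRel O) :
    Relativizes (fun O => NPRel O ⊆ PRel O → C O ⊆ PRel O) :=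
  fun _ hc => (hC _).trans (phRel_subset_PRel_of_collapse hc)

/-- … so its catch IS K world by world — a COSTUME cell everywhere, no strictness possible.
[cite: AroraBarakCC2009, Thm. 5.4] -/
theorem catch_iff_k_of_inPH {C : Oracle → Set (Language Bool)} (hP : ∀ O, PRel O ⊆ C O)
    (hC : ∀ O, C O ⊆ PHRel O) (O : Oracle) :
    (NPRel O ⊆ PRel O → PPRel O ⊆ C O) ↔ (NPRel O ⊆ PRel O → PPRel O ⊆ PRel O) :=
  ⟨fun h hc => (h hc).trans ((hC _).trans (phRel_subset_PRel_of_collapse hc)), fun hk hc => (hk hc).trans (hP _)⟩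

/-- Instance: «in Algorithmica PP ⊆ PH» is K in EVERY world. [cite: AroraBarakCC2009, Thm. 5.4 and §17.4] -/
theorem catchPH_iff_k (O : Oracle) :
    (NPRel O ⊆ PRel O → PPRel O ⊆ PHRel O) ↔ (NPRel O ⊆ PRel O → PPRel O ⊆ PRel O) :=
  catch_iff_k_of_inPH (fun O L hL => Set.mem_iUnion.2 ⟨0, show L ∈ SigmaPRel O 0 from hL⟩) (fun _ => subset_rfl) O

/-! ## §6 Modulo the print binder «AIK22 Thm 10» (`∃ B, NP^B ⊆ P^B ∧ PP^B ⊄ P^B ∧ PP^B ⊆ BQP^B`, a HYPOTHESIS) -/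

/-- **STRICTNESS, DECIDED mod the binder**: the quantum catch holds in a collapsing world where K fails — it is
relativized-STRICTLY BELOW K; hence no relativizing argument derives K from the quantum catch.
[cite: AaronsonIngramKretschmer2022, Thm. 10 (p. 8)] -/
theorem not_relativizes_qCatch_imp_k
    (h10 : ∃ B : Language Bool, NPRel (Oracle.ofLanguage B) ⊆ PRel (Oracle.ofLanguage B) ∧
      ¬ PPRel (Oracle.ofLanguage B) ⊆ PRel (Oracle.ofLanguage B) ∧
      PPRel (Oracle.ofLanguage B) ⊆ bqpRelOf (Oracle.ofLanguage B)) :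
    ¬ Relativizes (fun O => (NPRel O ⊆ PRel O → PPRel O ⊆ bqpRelOf O) → (NPRel O ⊆ PRel O → PPRel O ⊆ PRel O)) := by
  obtain ⟨B, hc, hK, hPB⟩ := h10
  exact fun hr => hK (hr B (fun _ => hPB) hc)

/-- The AWPP catch (N19's `AWCatch`, relativized) is strictly below K too (binder + tree fact `BQP^B ⊆ AWPP^B`).
[cite: AaronsonIngramKretschmer2022, Thm. 10] [cite: FortnowRogers1999JCSS, Thm. 3.1] -/
theorem not_relativizes_awCatch_imp_k
    (h10 : ∃ B : Language Bool, NPRel (Oracle.ofLanguage B) ⊆ PRel (Oracle.ofLanguage B) ∧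
      ¬ PPRel (Oracle.ofLanguage B) ⊆ PRel (Oracle.ofLanguage B) ∧
      PPRel (Oracle.ofLanguage B) ⊆ bqpRelOf (Oracle.ofLanguage B)) :
    ¬ Relativizes (fun O => (NPRel O ⊆ PRel O → PPRel O ⊆ AWPPRel O) → (NPRel O ⊆ PRel O → PPRel O ⊆ PRel O)) := by
  obtain ⟨B, hc, hK, hPB⟩ := h10
  have hBA : bqpRelOf (Oracle.ofLanguage B) ⊆ AWPPRel (Oracle.ofLanguage B) := by
    rw [presentsBQPRel_bqpRelOf B]
    exact Literature.Computability.QuantumComplexity.BQPRel_subset_AWPPRel_holds B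
  exact fun hr => hK (hr B (fun _ => hPB.trans hBA) hc)

/-- BARRIER TAGS (mod the binder): the BQP-lift (N19's `QLift`), the AWPP-lift and K FAIL at the binder world — none has
a relativizing proof. [cite: AaronsonIngramKretschmer2022, Thm. 10] -/
theorem not_relativizes_lifts
    (h10 : ∃ B : Language Bool, NPRel (Oracle.ofLanguage B) ⊆ PRel (Oracle.ofLanguage B) ∧
      ¬ PPRel (Oracle.ofLanguage B) ⊆ PRel (Oracle.ofLanguage B) ∧
      PPRel (Oracle.ofLanguage B) ⊆ bqpRelOf (Oracle.ofLanguage B)) :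
    ¬ Relativizes (fun O => NPRel O ⊆ PRel O → bqpRelOf O ⊆ PRel O) ∧
      ¬ Relativizes (fun O => NPRel O ⊆ PRel O → AWPPRel O ⊆ PRel O) ∧
      ¬ Relativizes (fun O => NPRel O ⊆ PRel O → PPRel O ⊆ PRel O) := by
  obtain ⟨B, hc, hK, hPB⟩ := h10
  have hBA : bqpRelOf (Oracle.ofLanguage B) ⊆ AWPPRel (Oracle.ofLanguage B) := by
    rw [presentsBQPRel_bqpRelOf B]
    exact Literature.Computability.QuantumComplexity.BQPRel_subset_AWPPRel_holds B
  exact ⟨fun hr => hK (hPB.trans (hr B hc)), fun hr => hK ((hPB.trans hBA).trans (hr B hc)),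
    fun hr => hK (hr B hc)⟩

/-! ## §7 Modulo the print binder «AIK22 Thm 4 / Cor 45» (a HYPOTHESIS = the antecedent of item 32933): the quantum catch is two-sided; world table; tests -/

/-- **THE QUANTUM CATCH IS NON-RELATIVIZING** (mod the binder; with `not_relativizes_neg` it is TWO-SIDED): at the
Thm-4 world `PP^B ⊄ BQP^B` while `NP^B ⊆ P^B`. [cite: AaronsonIngramKretschmer2022, Thm. 4 (p. 6) and Cor. 45 (p. 25)] -/
theorem not_relativizes_qCatch
    (h4 : ∃ B : Language Bool, NPRel (Oracle.ofLanguage B) ⊆ PRel (Oracle.ofLanguage B) ∧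
      ∃ L M : Language Bool, M ∈ BQPRel B ∧ L ∉ BQPRel B ∧
        L ∈ PPRel (Oracle.ofLanguage B) ∧ (M ∈ PRel (Oracle.ofLanguage B) → L ∈ NPRel (Oracle.ofLanguage B))) :
    ¬ Relativizes (fun O => NPRel O ⊆ PRel O → PPRel O ⊆ bqpRelOf O) := by
  obtain ⟨B, hc, L, M, -, hL, hLPP, -⟩ := h4
  exact fun hr => hL (by rw [← presentsBQPRel_bqpRelOf B]; exact hr B hc hLPP)

/-- **ROW (F,F) REALIZED — BQP STRICTLY INTERMEDIATE in a collapsing world** (mod the binder and the tree fact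
`P^B ⊆ BQP^B`): `NP^B ⊆ P^B`, K fails, the BQP-lift fails and the BQP-catch fails.
[cite: AaronsonIngramKretschmer2022, Thm. 4 and Cor. 45 with Claim 44] -/
theorem ff_row (hPB : Literature.Computability.QuantumComplexity.PRel_ofLanguage_subset_BQPRel)
    (h4 : ∃ B : Language Bool, NPRel (Oracle.ofLanguage B) ⊆ PRel (Oracle.ofLanguage B) ∧
      ∃ L M : Language Bool, M ∈ BQPRel B ∧ L ∉ BQPRel B ∧
        L ∈ PPRel (Oracle.ofLanguage B) ∧ (M ∈ PRel (Oracle.ofLanguage B) → L ∈ NPRel (Oracle.ofLanguage B))) :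
    ∃ B : Language Bool, NPRel (Oracle.ofLanguage B) ⊆ PRel (Oracle.ofLanguage B) ∧
      ¬ (NPRel (Oracle.ofLanguage B) ⊆ PRel (Oracle.ofLanguage B) → PPRel (Oracle.ofLanguage B) ⊆ PRel (Oracle.ofLanguage B)) ∧
      ¬ (NPRel (Oracle.ofLanguage B) ⊆ PRel (Oracle.ofLanguage B) → bqpRelOf (Oracle.ofLanguage B) ⊆ PRel (Oracle.ofLanguage B)) ∧
      ¬ (NPRel (Oracle.ofLanguage B) ⊆ PRel (Oracle.ofLanguage B) → PPRel (Oracle.ofLanguage B) ⊆ bqpRelOf (Oracle.ofLanguage B)) := by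
  obtain ⟨B, hc, L, M, hM, hL, hLPP, hML⟩ := h4
  have hPQ : PRel (Oracle.ofLanguage B) ⊆ bqpRelOf (Oracle.ofLanguage B) := by
    rw [presentsBQPRel_bqpRelOf B]; exact hPB B
  have hM' : M ∈ bqpRelOf (Oracle.ofLanguage B) := by rw [presentsBQPRel_bqpRelOf B]; exact hM
  have hL' : L ∉ bqpRelOf (Oracle.ofLanguage B) := by rw [presentsBQPRel_bqpRelOf B]; exact hL
  exact ⟨B, hc, fun hK => hL' (hPQ (hK hc hLPP)), fun hLift => hL' (hPQ (hc (hML (hLift hc hM')))),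
    fun hC => hL' (hC hc hLPP)⟩

/-- Row (F,T): at the Thm-10 binder world K and the BQP-lift FAIL and the BQP-catch HOLDS.
[cite: AaronsonIngramKretschmer2022, Thm. 10] -/
theorem ft_row
    (h10 : ∃ B : Language Bool, NPRel (Oracle.ofLanguage B) ⊆ PRel (Oracle.ofLanguage B) ∧
      ¬ PPRel (Oracle.ofLanguage B) ⊆ PRel (Oracle.ofLanguage B) ∧
      PPRel (Oracle.ofLanguage B) ⊆ bqpRelOf (Oracle.ofLanguage B)) :
    ∃ B : Language Bool, NPRel (Oracle.ofLanguage B) ⊆ PRel (Oracle.ofLanguage B) ∧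
      ¬ (NPRel (Oracle.ofLanguage B) ⊆ PRel (Oracle.ofLanguage B) → PPRel (Oracle.ofLanguage B) ⊆ PRel (Oracle.ofLanguage B)) ∧
      ¬ (NPRel (Oracle.ofLanguage B) ⊆ PRel (Oracle.ofLanguage B) → bqpRelOf (Oracle.ofLanguage B) ⊆ PRel (Oracle.ofLanguage B)) ∧
      (NPRel (Oracle.ofLanguage B) ⊆ PRel (Oracle.ofLanguage B) → PPRel (Oracle.ofLanguage B) ⊆ bqpRelOf (Oracle.ofLanguage B)) := by
  obtain ⟨B, hc, hK, hPB⟩ := h10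
  exact ⟨B, hc, fun hk => hK (hk hc), fun hL => hK (hPB.trans (hL hc)), fun _ => hPB⟩

/-- **`TQL` IS EXACTLY THE STRICTNESS OF `QLift` BELOW K** (hypothesis-free in this world-by-world form): a
collapsing world where the BQP-lift holds and K fails = a collapsing world with `BQP^B ⊆ P^B` and `PP^B ⊄ P^B` (row (T,F),
the open oracle question «P = NP = BQP ≠ PP»). [cite: AaronsonIngramKretschmer2022, §6] -/
theorem tQL_iff_strict_qLift :
    RootDecompQuantumCell.TQL ↔
      ∃ B : Language Bool, NPRel (Oracle.ofLanguage B) ⊆ PRel (Oracle.ofLanguage B) ∧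
        ¬ (NPRel (Oracle.ofLanguage B) ⊆ PRel (Oracle.ofLanguage B) → PPRel (Oracle.ofLanguage B) ⊆ PRel (Oracle.ofLanguage B)) ∧
        (NPRel (Oracle.ofLanguage B) ⊆ PRel (Oracle.ofLanguage B) → bqpRelOf (Oracle.ofLanguage B) ⊆ PRel (Oracle.ofLanguage B)) := by
  unfold RootDecompQuantumCell.TQL
  constructor
  · rintro ⟨B, hc, hQP, hPP⟩
    exact ⟨B, hc, fun hk => hPP (hk hc), fun _ => by rw [presentsBQPRel_bqpRelOf B]; exact hQP⟩
  · rintro ⟨B, hc, hK, hL⟩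
    exact ⟨B, hc, by rw [← presentsBQPRel_bqpRelOf B]; exact hL hc, fun hPP => hK (fun _ => hPP)⟩

/-- `TQC` ⟺ the quantum catch FAILS in some collapsing world (its relativized ledger form).
[cite: AaronsonIngramKretschmer2022, Thm. 4] -/
theorem tQC_iff_not_qCatch_somewhere :
    RootDecompQuantumCell.TQC ↔
      ∃ B : Language Bool, NPRel (Oracle.ofLanguage B) ⊆ PRel (Oracle.ofLanguage B) ∧
        ¬ (NPRel (Oracle.ofLanguage B) ⊆ PRel (Oracle.ofLanguage B) → PPRel (Oracle.ofLanguage B) ⊆ bqpRelOf (Oracle.ofLanguage B)) := by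
  unfold RootDecompQuantumCell.TQC
  constructor
  · rintro ⟨B, hc, hn⟩
    exact ⟨B, hc, fun hC => hn (by rw [← presentsBQPRel_bqpRelOf B]; exact hC hc)⟩
  · rintro ⟨B, hc, hC⟩
    exact ⟨B, hc, fun hn => hC (fun _ => by rw [presentsBQPRel_bqpRelOf B]; exact hn)⟩

/-- The AWPP cell's typed test implies the quantum one: a collapsing world with `PP^B ⊄ AWPP^B` has `PP^B ⊄ BQP^B`
(tree theorem `BQP^B ⊆ AWPP^B`), i.e. `T_AWC ⟹ TQC`. [cite: FortnowRogers1999JCSS, Thm. 3.1] -/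
theorem tQC_of_awTest
    (h : ∃ B : Language Bool, NPRel (Oracle.ofLanguage B) ⊆ PRel (Oracle.ofLanguage B) ∧
      ¬ PPRel (Oracle.ofLanguage B) ⊆ AWPPRel (Oracle.ofLanguage B)) :
    RootDecompQuantumCell.TQC := by
  unfold RootDecompQuantumCell.TQC
  obtain ⟨B, hc, hn⟩ := h
  exact ⟨B, hc, fun hPQ => hn (hPQ.trans (Literature.Computability.QuantumComplexity.BQPRel_subset_AWPPRel_holds B))⟩

/-- SUMMARY (mod both print binders): the quantum catch is strictly below K AND non-relativizing (two-sided with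
`not_relativizes_neg`); N19's `QLift` and K are non-relativizing; the only undecided relativized certificate of the quantum
cell is row (T,F) = `TQL` (stmt-PneNP-32699). [cite: AaronsonIngramKretschmer2022, Thm. 10 and Thm. 4] -/
theorem quantumCell_verdict
    (h10 : ∃ B : Language Bool, NPRel (Oracle.ofLanguage B) ⊆ PRel (Oracle.ofLanguage B) ∧
      ¬ PPRel (Oracle.ofLanguage B) ⊆ PRel (Oracle.ofLanguage B) ∧
      PPRel (Oracle.ofLanguage B) ⊆ bqpRelOf (Oracle.ofLanguage B))
    (h4 : ∃ B : Language Bool, NPRel (Oracle.ofLanguage B) ⊆ PRel (Oracle.ofLanguage B) ∧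
      ∃ L M : Language Bool, M ∈ BQPRel B ∧ L ∉ BQPRel B ∧
        L ∈ PPRel (Oracle.ofLanguage B) ∧ (M ∈ PRel (Oracle.ofLanguage B) → L ∈ NPRel (Oracle.ofLanguage B))) :
    ¬ Relativizes (fun O => (NPRel O ⊆ PRel O → PPRel O ⊆ bqpRelOf O) → (NPRel O ⊆ PRel O → PPRel O ⊆ PRel O)) ∧
      ¬ Relativizes (fun O => NPRel O ⊆ PRel O → PPRel O ⊆ bqpRelOf O) ∧
      ¬ Relativizes (fun O => NPRel O ⊆ PRel O → bqpRelOf O ⊆ PRel O) ∧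
      ¬ Relativizes (fun O => NPRel O ⊆ PRel O → PPRel O ⊆ PRel O) :=
  ⟨not_relativizes_qCatch_imp_k h10, not_relativizes_qCatch h4, (not_relativizes_lifts h10).1,
    (not_relativizes_lifts h10).2.2⟩

end Summit.PneNP.PneNP.Theorems.RootDecompCountingSandwichWorlds
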